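import Summits.ResolutionOfSingularities.ResolutionOfSingularities.Theses.FrobeniusClosing
import Literature.AlgebraicGeometry.Resolution.ResolutionLU

/-!
# Crux `Steer` (stmt-ResolutionOfSingularities-16345): the bookkeeping hypotheses of the consequent are load-bearing

Route `ResolutionOfSingularities/FrobeniusClosing`, crux #3 (shared verbatim with `WildCones` and
`JacobianBudget`):
`Steer := IsolatedForcedTermination → ∀ p prime, ∀ perfect k of char p, K ⊇ k, O a valuation ring
of K, A₀ ⊆ O f.g. regular at the centre, t with t ^ p ∈ A₀ and Frac (A₀[t]) = K, ∃ f.g. A with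
A₀[t] ⊆ A ⊆ O, Frac A = K, A regular at the centre`.

Negative-side load-bearing analysis (cdisprove seat, 2026-08-17), everything PROVED, no definition
introduced (each hypothesis-deleted variant of the CONSEQUENT is stated INLINE, otherwise verbatim,
`[PerfectField k]` kept; helper `isRegularLocalRing_localizationAtPrime_of_le_bot`):

* `steerConseq_false_without_frac` — delete `IsFractionRing (A₀[t]) K`: FALSE. Witness `k = 𝔽_p`,
  `K = 𝔽_p^alg` (perfect base!), `O = K`, `A₀ = k`, `t = 0`: a finitely generated `A ⊆ K` with
  `Frac A = K` is integral, hence finite over `𝔽_p`, hence a finite field onto which `K` cannot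
  biject.
* `steerConseq_false_without_fg` — delete `A₀.FG`: FALSE. Witness `K = 𝔽_p(X)`, `A₀ = O = K`,
  `t = 0`: the conclusion forces `K` to be a finitely generated `𝔽_p`-algebra, and a field that is
  a finitely generated algebra is finite (Zariski's lemma), but `X` is transcendental.
* `steerConseq_false_without_torsor` — delete `t ^ p ∈ A₀`: FALSE for a junk reason (`t ∉ O`
  becomes possible): `K = 𝔽_p(X)`, `A₀ = k`, `O = 𝒪_∞`, `t = X`.
* `steerWithoutFrac_iff_not_isolatedForcedTermination` (and `…FG…`, `…Torsor…`) — at CRUX level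
  (antecedent kept) each mutation `IsolatedForcedTermination → (mutated consequent)` is EQUIVALENT
  to the NEGATION of the route's own target `IsolatedForcedTermination` (stmt-16343): it holds iff
  the target fails. So modulo the target every one of the three hypotheses is load-bearing, and
  unconditionally none of the three mutations is available to a prover of the route.

Moral for provers: all three are junk-level (they pin the typing: `K/k` finitely generated, a
finitely generated base, `t ∈ O`); the hypotheses that carry mathematics (`[PerfectField k]`,
regularity of the base, the antecedent) cannot be shown load-bearing by counterexample because
deleting any of them lands on a statement implied by the summit (`Cruxes/Steer/Disproof.lean` §1–§2).
Does NOT refute the crux.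
-/

noncomputable section

set_option linter.dupNamespace false

open IsLocalRing
open Summit.ResolutionOfSingularities.ResolutionOfSingularities.Theses.FrobeniusClosing
  (IsolatedForcedTermination)
open Literature.AlgebraicGeometry.Resolution (isFractionRing_of_le)

namespace Summit.ResolutionOfSingularities.ResolutionOfSingularities.Theorems.Steer.Negative

/-! ### Helpers -/

section Helpers

variable {k K : Type} [Field k] [Field K] [Algebra k K]

/-- The localisation of a Noetherian domain at a prime contained in `(0)` is a regular local ring
(it is a field: its maximal ideal is `0`). [folklore] -/
theorem isRegularLocalRing_localizationAtPrime_of_le_bot {R : Type*} [CommRing R] [IsDomain R]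
    [IsNoetherianRing R] (I : Ideal R) [I.IsPrime] (hI : I ≤ ⊥) :
    IsRegularLocalRing (Localization.AtPrime I) := by
  obtain rfl : I = ⊥ := le_bot_iff.mp hI
  apply IsRegularLocalRing.of_spanFinrank_maximalIdeal_le
  have hm : maximalIdeal (Localization.AtPrime (⊥ : Ideal R)) = ⊥ := by
    rw [← Localization.AtPrime.map_eq_maximalIdeal, Ideal.map_bot]
  rw [hm, Submodule.spanFinrank_bot]
  exact ringKrullDim_nonneg_of_nontrivial

/-- The centre of the trivial valuation ring `O = K` on any model is the zero ideal. [folklore] -/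
theorem centre_top_eq_bot (A : Subalgebra k K)
    (h : A.toSubring ≤ (⊤ : ValuationSubring K).toSubring) :
    Ideal.comap (Subring.inclusion h) (maximalIdeal (⊤ : ValuationSubring K)) = ⊥ := by
  rw [maximalIdeal_eq_bot, Ideal.comap_bot_of_injective]
  exact Subring.inclusion_injective _

/-- A proper ideal of the bottom subalgebra `k ⊆ K` (a field) is zero. [folklore] -/
theorem ideal_bot_eq_bot (I : Ideal (⊥ : Subalgebra k K).toSubring) (hI : I ≠ ⊤) : I = ⊥ := by
  refine (Submodule.eq_bot_iff _).mpr fun x hx => ?_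
  by_contra hx0
  apply hI
  refine Ideal.eq_top_of_isUnit_mem _ hx ?_
  have hxmem : (x : K) ∈ (⊥ : Subalgebra k K) := x.2
  rw [Algebra.mem_bot] at hxmem
  obtain ⟨c, hc⟩ := hxmem
  have hc0 : c ≠ 0 := by
    rintro rfl
    apply hx0
    apply Subtype.ext
    simp [← hc]
  have hinv : algebraMap k K c⁻¹ ∈ (⊥ : Subalgebra k K).toSubring :=
    Subalgebra.algebraMap_mem _ _
  refine isUnit_iff_exists_inv.mpr ⟨⟨algebraMap k K c⁻¹, hinv⟩, ?_⟩
  apply Subtype.ext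
  change (x : K) * algebraMap k K c⁻¹ = 1
  rw [← hc, ← map_mul, mul_inv_cancel₀ hc0, map_one]

end Helpers

/-! ### `Frac (A₀[t]) = K` is load-bearing (witness `K = 𝔽_p^alg`, `O = K`, `A₀ = k`, `t = 0`) -/

/-- **`IsFractionRing (A₀[t]) K` is load-bearing**: the consequent of `Steer` at a prime `p` with
that hypothesis deleted (stated inline, otherwise verbatim, `[PerfectField k]` kept) is FALSE —
witness `k = 𝔽_p`, `K = 𝔽_p^alg`, `O = K`, `A₀ = k`, `t = 0`. [folklore] -/
theorem steerConseq_false_without_frac (p : ℕ) [hp : Fact p.Prime] :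
    ¬ (∀ (k K : Type) [Field k] [CharP k p] [PerfectField k] [Field K] [Algebra k K]
      (O : ValuationSubring K) (A₀ : Subalgebra k K) (h₀ : A₀.toSubring ≤ O.toSubring) (t : K),
      A₀.FG → t ^ p ∈ A₀ →
      IsRegularLocalRing (Localization.AtPrime (Ideal.comap (Subring.inclusion h₀)
        (IsLocalRing.maximalIdeal O))) →
      ∃ (A : Subalgebra k K) (h : A.toSubring ≤ O.toSubring), A₀ ≤ A ∧ t ∈ A ∧ A.FG ∧
        IsFractionRing A K ∧ IsRegularLocalRing (Localization.AtPrime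
          (Ideal.comap (Subring.inclusion h) (IsLocalRing.maximalIdeal O)))) := by
  intro H
  let k := ZMod p
  let K := AlgebraicClosure (ZMod p)
  have h₀ : (⊥ : Subalgebra k K).toSubring ≤ (⊤ : ValuationSubring K).toSubring :=
    fun _ _ => Subring.mem_top _
  have hreg : IsRegularLocalRing (Localization.AtPrime (Ideal.comap (Subring.inclusion h₀)
      (IsLocalRing.maximalIdeal (⊤ : ValuationSubring K)))) := by
    haveI : IsNoetherianRing (⊥ : Subalgebra k K).toSubring :=
      isNoetherianRing_of_fg Subalgebra.fg_bot
    exact isRegularLocalRing_localizationAtPrime_of_le_bot _ (centre_top_eq_bot _ h₀).le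
  obtain ⟨A, h, -, -, hAfg, hAfr, -⟩ := H k K ⊤ ⊥ h₀ 0 Subalgebra.fg_bot
    (by rw [zero_pow hp.out.ne_zero]; exact zero_mem _) hreg
  -- `A` is integral and of finite type over `𝔽_p`, hence finite, hence a finite field
  haveI : Algebra.FiniteType k A := A.fg_iff_finiteType.mp hAfg
  haveI : Algebra.IsIntegral k A := ⟨fun a =>
    (isIntegral_algHom_iff A.val Subtype.val_injective).mp (Algebra.IsIntegral.isIntegral (a : K))⟩
  haveI : Module.Finite k A := Algebra.IsIntegral.finite
  haveI : Finite A := Module.finite_of_finite k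
  have hfield : IsField A := Finite.isField_of_domain A
  have hbij := hfield.localization_map_bijective (M := nonZeroDivisors A) (Rₘ := K)
    zero_notMem_nonZeroDivisors
  haveI : Finite K := Finite.of_surjective _ hbij.2
  exact not_finite K

/-! ### `A₀.FG` is load-bearing (witness `K = 𝔽_p(X)`, `A₀ = O = K`, `t = 0`) -/

/-- **`A₀.FG` is load-bearing**: the consequent of `Steer` at a prime `p` with `A₀.FG` deleted
(stated inline, otherwise verbatim, `[PerfectField k]` kept) is FALSE — witness `k = 𝔽_p`,
`K = 𝔽_p(X)`, `A₀ = O = K`, `t = 0`; a field finitely generated as an algebra is finite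
(Zariski's lemma) and `X` is transcendental. [folklore] -/
theorem steerConseq_false_without_fg (p : ℕ) [hp : Fact p.Prime] :
    ¬ (∀ (k K : Type) [Field k] [CharP k p] [PerfectField k] [Field K] [Algebra k K]
      (O : ValuationSubring K) (A₀ : Subalgebra k K) (h₀ : A₀.toSubring ≤ O.toSubring) (t : K),
      t ^ p ∈ A₀ → IsFractionRing (Algebra.adjoin k (insert t (A₀ : Set K))) K →
      IsRegularLocalRing (Localization.AtPrime (Ideal.comap (Subring.inclusion h₀)
        (IsLocalRing.maximalIdeal O))) →
      ∃ (A : Subalgebra k K) (h : A.toSubring ≤ O.toSubring), A₀ ≤ A ∧ t ∈ A ∧ A.FG ∧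
        IsFractionRing A K ∧ IsRegularLocalRing (Localization.AtPrime
          (Ideal.comap (Subring.inclusion h) (IsLocalRing.maximalIdeal O)))) := by
  intro H
  let k := ZMod p
  let K := RatFunc (ZMod p)
  have h₀ : (⊤ : Subalgebra k K).toSubring ≤ (⊤ : ValuationSubring K).toSubring :=
    fun _ _ => Subring.mem_top _
  have hreg : IsRegularLocalRing (Localization.AtPrime (Ideal.comap (Subring.inclusion h₀)
      (IsLocalRing.maximalIdeal (⊤ : ValuationSubring K)))) := by
    haveI : IsNoetherianRing (⊤ : Subalgebra k K).toSubring :=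
      isNoetherianRing_of_ringEquiv K (Subalgebra.topEquiv (R := k) (A := K)).toRingEquiv.symm
    exact isRegularLocalRing_localizationAtPrime_of_le_bot _ (centre_top_eq_bot _ h₀).le
  have hfr : IsFractionRing (Algebra.adjoin k (insert (0 : K) ((⊤ : Subalgebra k K) : Set K))) K :=
    isFractionRing_of_le (fun _ hx => Algebra.subset_adjoin (Set.mem_insert_of_mem _ hx)) <|
      IsFractionRing.of_field (⊤ : Subalgebra k K) K fun z =>
        ⟨⟨z, Algebra.mem_top⟩, 1, by simp⟩
  obtain ⟨A, h, htopA, -, hAfg, -, -⟩ := H k K ⊤ ⊤ h₀ 0 (Algebra.mem_top) hfr hreg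
  have hA : A = ⊤ := top_le_iff.mp htopA
  subst hA
  haveI : Algebra.FiniteType k K := ⟨hAfg⟩
  haveI : Module.Finite k K := finite_of_finite_type_of_isJacobsonRing k K
  have halg : Algebra.IsAlgebraic k K := Algebra.IsAlgebraic.of_finite k K
  have hX : Transcendental k (RatFunc.X : K) := by
    rw [← RatFunc.algebraMap_X, transcendental_algebraMap_iff (RatFunc.algebraMap_injective k)]
    exact Polynomial.transcendental_X k
  exact hX (halg.isAlgebraic _)

/-! ### `t ^ p ∈ A₀` is load-bearing, for a junk reason (witness `K = 𝔽_p(X)`, `O = 𝒪_∞`, `t = X`) -/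

/-- **`t ^ p ∈ A₀` is load-bearing, but only for a junk reason**: it is the only hypothesis forcing
`t ∈ O`, while the conclusion demands `t ∈ A ⊆ O`. The consequent of `Steer` at `p` with it deleted
(inline, otherwise verbatim, `[PerfectField k]` kept) is FALSE — witness `k = 𝔽_p`, `K = 𝔽_p(X)`,
`A₀ = k`, `t = X`, `O = 𝒪_∞` (`X ∉ 𝒪_∞`). [folklore] -/
theorem steerConseq_false_without_torsor (p : ℕ) [hp : Fact p.Prime] :
    ¬ (∀ (k K : Type) [Field k] [CharP k p] [PerfectField k] [Field K] [Algebra k K]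
      (O : ValuationSubring K) (A₀ : Subalgebra k K) (h₀ : A₀.toSubring ≤ O.toSubring) (t : K),
      A₀.FG → IsFractionRing (Algebra.adjoin k (insert t (A₀ : Set K))) K →
      IsRegularLocalRing (Localization.AtPrime (Ideal.comap (Subring.inclusion h₀)
        (IsLocalRing.maximalIdeal O))) →
      ∃ (A : Subalgebra k K) (h : A.toSubring ≤ O.toSubring), A₀ ≤ A ∧ t ∈ A ∧ A.FG ∧
        IsFractionRing A K ∧ IsRegularLocalRing (Localization.AtPrime
          (Ideal.comap (Subring.inclusion h) (IsLocalRing.maximalIdeal O)))) := by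
  classical
  intro H
  let k := ZMod p
  let K := RatFunc (ZMod p)
  let O : ValuationSubring K := (RatFunc.inftyValuation k).valuationSubring
  have hXO : (RatFunc.X : K) ∉ O := by
    change ¬ (RatFunc.inftyValuation k (RatFunc.X : K) ≤ 1)
    rw [not_le, RatFunc.inftyValuation.X, ← WithZero.exp_zero, WithZero.exp_lt_exp]
    exact zero_lt_one
  have h₀ : (⊥ : Subalgebra k K).toSubring ≤ O.toSubring := by
    intro x hx
    have hx' : x ∈ (⊥ : Subalgebra k K) := hx
    rw [Algebra.mem_bot] at hx'
    obtain ⟨c, rfl⟩ := hx'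
    change RatFunc.inftyValuation k (algebraMap k K c) ≤ 1
    by_cases hc : c = 0
    · simp [hc]
    · have : (algebraMap k K c) = RatFunc.C c := rfl
      rw [this, RatFunc.inftyValuation.C k hc]
  have hreg : IsRegularLocalRing (Localization.AtPrime (Ideal.comap (Subring.inclusion h₀)
      (IsLocalRing.maximalIdeal O))) := by
    haveI : IsNoetherianRing (⊥ : Subalgebra k K).toSubring :=
      isNoetherianRing_of_fg Subalgebra.fg_bot
    exact isRegularLocalRing_localizationAtPrime_of_le_bot _ (ideal_bot_eq_bot _ Ideal.IsPrime.ne_top').le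
  have hfr : IsFractionRing (Algebra.adjoin k (insert (RatFunc.X : K)
      ((⊥ : Subalgebra k K) : Set K))) K := by
    refine IsFractionRing.of_field _ K fun z => ?_
    have hmem : ∀ q : Polynomial k, algebraMap (Polynomial k) K q ∈
        Algebra.adjoin k (insert (RatFunc.X : K) ((⊥ : Subalgebra k K) : Set K)) := by
      intro q
      have : algebraMap (Polynomial k) K q = Polynomial.aeval (RatFunc.X : K) q := by
        rw [← RatFunc.algebraMap_X, Polynomial.aeval_algebraMap_apply,
          Polynomial.aeval_X_left_apply]
      rw [this]
      exact Algebra.adjoin_mono (Set.singleton_subset_iff.mpr (Set.mem_insert _ _))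
        (Polynomial.aeval_mem_adjoin_singleton k _)
    refine ⟨⟨_, hmem z.num⟩, ⟨_, hmem z.denom⟩, ?_⟩
    exact (RatFunc.num_div_denom z).symm
  obtain ⟨A, h, -, htA, -, -, -⟩ := H k K O ⊥ h₀ RatFunc.X Subalgebra.fg_bot hfr hreg
  exact hXO (h htA)

/-! ### At crux level: each mutation holds iff the route's target fails -/

/-- **`Steer` without `IsFractionRing (A₀[t]) K` (antecedent kept, consequent mutated inline) holds
iff the route's target `IsolatedForcedTermination` FAILS.** In particular it is refuted by any
proof of the target, and it is not available to a prover of the route. [folklore] -/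
theorem steerWithoutFrac_iff_not_isolatedForcedTermination :
    (IsolatedForcedTermination → ∀ p : ℕ, p.Prime →
      ∀ (k K : Type) [Field k] [CharP k p] [PerfectField k] [Field K] [Algebra k K]
      (O : ValuationSubring K) (A₀ : Subalgebra k K) (h₀ : A₀.toSubring ≤ O.toSubring) (t : K),
      A₀.FG → t ^ p ∈ A₀ →
      IsRegularLocalRing (Localization.AtPrime (Ideal.comap (Subring.inclusion h₀)
        (IsLocalRing.maximalIdeal O))) →
      ∃ (A : Subalgebra k K) (h : A.toSubring ≤ O.toSubring), A₀ ≤ A ∧ t ∈ A ∧ A.FG ∧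
        IsFractionRing A K ∧ IsRegularLocalRing (Localization.AtPrime
          (Ideal.comap (Subring.inclusion h) (IsLocalRing.maximalIdeal O)))) ↔
    ¬ IsolatedForcedTermination := by
  constructor
  · intro H hT
    haveI : Fact (Nat.Prime 2) := ⟨Nat.prime_two⟩
    exact steerConseq_false_without_frac 2 (H hT 2 Nat.prime_two)
  · exact fun hn hT => absurd hT hn

/-- **`Steer` without `A₀.FG` (antecedent kept) holds iff the route's target fails.** [folklore] -/
theorem steerWithoutFG_iff_not_isolatedForcedTermination :
    (IsolatedForcedTermination → ∀ p : ℕ, p.Prime →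
      ∀ (k K : Type) [Field k] [CharP k p] [PerfectField k] [Field K] [Algebra k K]
      (O : ValuationSubring K) (A₀ : Subalgebra k K) (h₀ : A₀.toSubring ≤ O.toSubring) (t : K),
      t ^ p ∈ A₀ → IsFractionRing (Algebra.adjoin k (insert t (A₀ : Set K))) K →
      IsRegularLocalRing (Localization.AtPrime (Ideal.comap (Subring.inclusion h₀)
        (IsLocalRing.maximalIdeal O))) →
      ∃ (A : Subalgebra k K) (h : A.toSubring ≤ O.toSubring), A₀ ≤ A ∧ t ∈ A ∧ A.FG ∧
        IsFractionRing A K ∧ IsRegularLocalRing (Localization.AtPrime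
          (Ideal.comap (Subring.inclusion h) (IsLocalRing.maximalIdeal O)))) ↔
    ¬ IsolatedForcedTermination := by
  constructor
  · intro H hT
    haveI : Fact (Nat.Prime 2) := ⟨Nat.prime_two⟩
    exact steerConseq_false_without_fg 2 (H hT 2 Nat.prime_two)
  · exact fun hn hT => absurd hT hn

/-- **`Steer` without `t ^ p ∈ A₀` (antecedent kept) holds iff the route's target fails.**
[folklore] -/
theorem steerWithoutTorsor_iff_not_isolatedForcedTermination :
    (IsolatedForcedTermination → ∀ p : ℕ, p.Prime →
      ∀ (k K : Type) [Field k] [CharP k p] [PerfectField k] [Field K] [Algebra k K]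
      (O : ValuationSubring K) (A₀ : Subalgebra k K) (h₀ : A₀.toSubring ≤ O.toSubring) (t : K),
      A₀.FG → IsFractionRing (Algebra.adjoin k (insert t (A₀ : Set K))) K →
      IsRegularLocalRing (Localization.AtPrime (Ideal.comap (Subring.inclusion h₀)
        (IsLocalRing.maximalIdeal O))) →
      ∃ (A : Subalgebra k K) (h : A.toSubring ≤ O.toSubring), A₀ ≤ A ∧ t ∈ A ∧ A.FG ∧
        IsFractionRing A K ∧ IsRegularLocalRing (Localization.AtPrime
          (Ideal.comap (Subring.inclusion h) (IsLocalRing.maximalIdeal O)))) ↔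
    ¬ IsolatedForcedTermination := by
  constructor
  · intro H hT
    haveI : Fact (Nat.Prime 2) := ⟨Nat.prime_two⟩
    exact steerConseq_false_without_torsor 2 (H hT 2 Nat.prime_two)
  · exact fun hn hT => absurd hT hn

end Summit.ResolutionOfSingularities.ResolutionOfSingularities.Theorems.Steer.Negative
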